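import Mathlib
import HarnessLib
import Literature.AlgebraicGeometry.Resolution.BlowupDisjointCentreSplitting
import Literature.AlgebraicGeometry.Resolution.RegularCentreComponents
import Summits.ResolutionOfSingularities.ResolutionOfSingularities.Theorems.WildQuotientsWildQuotientResolutionKSBlowupFixedPointCentre

/-!
# Kollár–Szabó going down for ORBIT blow-ups: blowing up a finite stable set of closed points (the orbit `G·x`)
# keeps, over `x`, a closed regular point fixed by the whole p-closed stabiliser with the same inertia
# (crux `WildQuotients.WildQuotientResolution`, stub `stub_phaseZeroHighDim`)

Crux stmt-ResolutionOfSingularities-15640 (`WildQuotientResolution`), registered stub `stub_phaseZeroHighDim`;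
programme PHASE0-KS-EIGENLINE. The Phase-0 move «blow up the orbit of a closed point» is the blowing up along the
reduced ideal of a finite `G`-stable closed set `Z` of closed points, with the lifted `G`-action
(✓`IsBlowup.liftAction`, ✓`vanishingIdeal_comap_eq_of_action`). At `x ∈ Z` one has `(𝓘_Z)_x = 𝔪_x`, so hand 8-g2's
general-centre step (✓`exists_fixedPoint_liftAction_step_of_normal_isPGroup_of_centre`, p830063) applies to the
STABILISER subgroup `H ≤ I_x`:

* `stalkIdeal_vanishingIdeal_of_isClosed_diff` — `(𝓘_Z)_x = 𝔪_x` for `x ∈ Z` with `Z ∖ {x}` closed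
  (✓`vanishingIdeal_sup_eq_mul_of_disjoint`, ✓`stalkIdeal_mul`, ✓`stalkIdeal_vanishingIdeal_of_not_mem`);
  `isClosed_diff_singleton_of_finite` — automatic for a finite set of closed points;
* `liftAction_comp_subtype_apply` — the lift of the restricted action `σ|_H` is the restriction of the lift of `σ`;
* ★ `exists_fixedPoint_liftAction_orbit_step` — **for an integral locally Noetherian `X` with an action `σ` of a finite
  group `G`, a finite `G`-stable closed set `Z` of closed points, `x ∈ Z` with `𝒪_{X,x}` regular, not a field,
  `κ(x)` algebraically closed of characteristic `p`, and a subgroup `H ≤ I_x` which is p-closed with abelian tame part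
  (`H ⊵ P ⊇ [H,H]`, `P` a `p`-group): on ANY blowing up `π : X' → X` along `𝓘_Z` with the lifted `G`-action there is
  a CLOSED point `x'` over `x` with `h ∈ I_{x'}` for every `h ∈ H`, `𝒪_{X',x'}` regular, not a field, of the same
  dimension, `κ(x') ≅ κ(x)`** — orbit blow-ups never shrink such stabilisers.

[OURS · crux stmt-ResolutionOfSingularities-15640 · helper toward `stub_phaseZeroHighDim` (orbit form of the
Kollár–Szabó fixed point; NOT a proof of the stub); counted 0; AI-level work, weaker than expert review.]
[cite: ReichsteinYoussin2000, Appendix (Kollár–Szabó), Lemma A.1 and Prop. A.2]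
-/

-- single-problem summit: the doubled namespace component `ResolutionOfSingularities` is forced
set_option linter.dupNamespace false

noncomputable section

open CategoryTheory CategoryTheory.Limits AlgebraicGeometry TopologicalSpace IsLocalRing
open Literature.AlgebraicGeometry.Ramification Literature.AlgebraicGeometry.Resolution
open Scheme.IdealSheafData
open Summit.ResolutionOfSingularities.ResolutionOfSingularities.Theorems.WildQuotientResolution

namespace Summit.ResolutionOfSingularities.ResolutionOfSingularities.Theorems.WildQuotientResolution.KSGoingDown

/-! ## The stalk of the ideal of a finite set of closed points -/

/-- **`(𝓘_Z)_x = 𝔪_x` at a point `x ∈ Z` which is closed with `Z ∖ {x}` closed**: `Z = {x} ⊔ (Z ∖ {x})` disjoint,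
`𝓘_Z = 𝓘_{x} · 𝓘_{Z∖{x}}`, and the second factor has unit stalk at `x`. [folklore] -/
theorem stalkIdeal_vanishingIdeal_of_isClosed_diff {X : Scheme.{0}} (Z : Closeds X) {x : X} (hxZ : x ∈ Z)
    (hx : IsClosed ({x} : Set X)) (hZ' : IsClosed ((Z : Set X) \ {x})) :
    stalkIdeal (vanishingIdeal Z) x = maximalIdeal (X.presheaf.stalk x) := by
  have hZeq : Z = (⟨{x}, hx⟩ : Closeds X) ⊔ ⟨(Z : Set X) \ {x}, hZ'⟩ := by
    apply Closeds.ext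
    simp only [Closeds.coe_sup, Closeds.coe_mk]
    rw [Set.union_comm, Set.sdiff_union_of_subset (Set.singleton_subset_iff.mpr hxZ)]
  have hdisj : Disjoint (((⟨{x}, hx⟩ : Closeds X)) : Set X) ((⟨(Z : Set X) \ {x}, hZ'⟩ : Closeds X) : Set X) := by
    change Disjoint ({x} : Set X) ((Z : Set X) \ {x})
    exact Set.disjoint_sdiff_right
  rw [hZeq, vanishingIdeal_sup_eq_mul_of_disjoint hdisj, stalkIdeal_mul, stalkIdeal_vanishingIdeal_singleton hx,
    stalkIdeal_vanishingIdeal_of_not_mem (Z := ⟨(Z : Set X) \ {x}, hZ'⟩) (by simp), Ideal.mul_top]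

/-- A finite set of closed points minus one of them is closed. [folklore] -/
theorem isClosed_diff_singleton_of_finite {X : Scheme.{0}} {Z : Set X} (hZfin : Z.Finite)
    (hZcl : ∀ z ∈ Z, IsClosed ({z} : Set X)) (x : X) : IsClosed (Z \ {x}) := by
  have : Z \ {x} = ⋃ z ∈ Z \ {x}, {z} := (Set.biUnion_of_singleton _).symm
  rw [this]
  exact (hZfin.sdiff).isClosed_biUnion fun z hz => hZcl z hz.1

/-! ## Restricting the lifted action to a subgroup -/

/-- The lift of the restricted action `σ ∘ H.subtype` agrees with the lift of `σ` on `H`. [folklore] -/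
theorem liftAction_comp_subtype_apply {X' X : Scheme.{0}} {π : X' ⟶ X} {I : X.IdealSheafData} (hπ : IsBlowup π I)
    {G : Type} [Group G] (σ : G →* Aut X) (hI : ∀ g, I.comap (σ g).hom = I) (H : Subgroup G) (h : H) :
    hπ.liftAction (σ.comp H.subtype) (fun h => hI (h : G)) h = hπ.liftAction σ hI (h : G) := by
  rw [IsBlowup.liftAction_apply, IsBlowup.liftAction_apply]
  rfl

/-! ## The orbit step -/

/-- **Kollár–Szabó fixed point for ORBIT blow-ups.** Let `G` (finite) act on an integral locally Noetherian `X`,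
`Z` a finite `G`-stable closed set of closed points, `x ∈ Z` with `𝒪_{X,x}` regular, not a field, and `κ(x)`
algebraically closed of characteristic `p`; let `H ≤ G` consist of elements of the inertia group `I_x` and be
p-closed with abelian tame part (`P ⊴ H` a `p`-group containing all commutators of `H`). For ANY blowing up
`π : X' → X` along `𝓘_Z`, with the lifted `G`-action, there is a CLOSED point `x' ∈ X'` over `x` with `h ∈ I_{x'}`
for all `h ∈ H`, `𝒪_{X',x'}` regular, not a field, `dim 𝒪_{X',x'} = dim 𝒪_{X,x}`, and `κ(x') ≅ κ(x)`.
[cite: ReichsteinYoussin2000, Appendix (Kollár–Szabó), Lemma A.1 and Prop. A.2] -/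
theorem exists_fixedPoint_liftAction_orbit_step {X : Scheme.{0}} [IsIntegral X] [IsLocallyNoetherian X]
    {G : Type} [Group G] [Finite G] {p : ℕ} [Fact p.Prime] (σ : G →* Aut X)
    (Z : Closeds X) (hZst : ∀ g, (σ g).hom.base ⁻¹' (Z : Set X) = Z) (hZfin : (Z : Set X).Finite)
    (hZcl : ∀ z ∈ (Z : Set X), IsClosed ({z} : Set X)) {x : X} (hxZ : x ∈ Z)
    (H : Subgroup G) (hH : ∀ h : H, (h : G) ∈ inertiaSubgroup σ x)
    (P : Subgroup H) [P.Normal] (hP : IsPGroup p P) (hcomm : ∀ g h : H, g * h * g⁻¹ * h⁻¹ ∈ P)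
    [IsRegularLocalRing (X.presheaf.stalk x)] [CharP (ResidueField (X.presheaf.stalk x)) p]
    [IsAlgClosed (ResidueField (X.presheaf.stalk x))] (hnf : ¬ IsField (X.presheaf.stalk x))
    {X' : Scheme.{0}} {π : X' ⟶ X} (hπ : IsBlowup π (vanishingIdeal Z)) :
    IsIntegral X' ∧ IsLocallyNoetherian X' ∧
    ∃ x' : X', π x' = x ∧ IsClosed ({x'} : Set X') ∧
      (∀ h : H, (h : G) ∈ inertiaSubgroup (hπ.liftAction σ (vanishingIdeal_comap_eq_of_action σ Z hZst)) x') ∧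
      IsRegularLocalRing (X'.presheaf.stalk x') ∧ ¬ IsField (X'.presheaf.stalk x') ∧
      ringKrullDim (X'.presheaf.stalk x') = ringKrullDim (X.presheaf.stalk x) ∧
      Nonempty (ResidueField (X'.presheaf.stalk x') ≃+* ResidueField (X.presheaf.stalk x)) := by
  have hx : IsClosed ({x} : Set X) := hZcl x hxZ
  -- the restricted action of `H` and its hypotheses
  let σH : H →* Aut X := σ.comp H.subtype
  have hGx : ∀ h : H, h ∈ inertiaSubgroup σH x := fun h => hH h
  have hI : ∀ h : H, (vanishingIdeal Z).comap (σH h).hom = vanishingIdeal Z :=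
    fun h => vanishingIdeal_comap_eq_of_action σ Z hZst (h : G)
  have hIx : stalkIdeal (vanishingIdeal Z) x = maximalIdeal (X.presheaf.stalk x) :=
    stalkIdeal_vanishingIdeal_of_isClosed_diff Z hxZ hx (isClosed_diff_singleton_of_finite hZfin hZcl x)
  -- `𝓘_Z ≠ 0`: the generic point is not in `Z`
  have hI0 : vanishingIdeal Z ≠ ⊥ := by
    intro h
    have hmem : genericPoint X ∈ (Z : Set X) := by
      have := congrArg (fun I : X.IdealSheafData => (I.support : Set X)) h
      simp only [Scheme.IdealSheafData.coe_support_vanishingIdeal, Scheme.IdealSheafData.support_bot,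
        Closeds.coe_top] at this
      rw [this]; exact Set.mem_univ _
    have hgen : IsClosed ({genericPoint X} : Set X) := hZcl _ hmem
    have hxg : x ∈ closure ({genericPoint X} : Set X) := by
      rw [genericPoint_closure]; exact Set.mem_univ _
    rw [hgen.closure_eq, Set.mem_singleton_iff] at hxg
    exact genericPoint_ne_of_not_isField hnf hxg.symm
  obtain ⟨hint, hnoeth, x', hx'x, hcl, hinert, hreg, hnf', hdim, hres⟩ :=
    exists_fixedPoint_liftAction_step_of_normal_isPGroup_of_centre P hP hcomm σH hx hGx hnf hI hI0 hIx hπ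
  refine ⟨hint, hnoeth, x', hx'x, hcl, fun h => ?_, hreg, hnf', hdim, hres⟩
  have := hinert h
  rwa [mem_inertiaSubgroup_iff, liftAction_comp_subtype_apply hπ σ
    (vanishingIdeal_comap_eq_of_action σ Z hZst) H h] at this

end Summit.ResolutionOfSingularities.ResolutionOfSingularities.Theorems.WildQuotientResolution.KSGoingDown

end
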